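import Literature.Algebra.Lie.LefschetzStringInvariantForm
import Literature.Algebra.Lie.LefschetzSl2TypeIsotypic
import Literature.Algebra.Lie.LefschetzModulePrimitive
import Literature.Algebra.Lie.LefschetzModuleInvariantFormIrreducible
import HarnessLib

/-!
# Irreducible Lefschetz modules over a line `𝔞 = K·a` are strings `V(n)`; their invariant forms are `(-1)^n`-symmetric (Looijenga–Lunts 1997, §1 (1.15)–(1.16))

Topic `Literature/Algebra/Lie` (namespace `Literature.Algebra.Lie`).  Lane `lit-hodgefound` (Track 2 foundations
library), skeleton seat `lit-hodgefound-skel-1` (generation 43), row **A1-124** of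
`run/shared/lean/pub/lit-hodgefound/SKELETON.md`: the rank-one case of Looijenga–Lunts' (1.15)/(1.16) in the
vocabulary of A1-88 (`IsLefschetzModule K h (K ∙ a)`): an irreducible Lefschetz module over the LINE `𝔞 = K·a` is the
single `a`-string `K·v + K·av + ⋯ + K·aⁿv` of any non-zero bottom vector `v ∈ M_{-n}` (`n = depth M`), i.e. it is
`V(n)` ((1.15): for `𝔤 = 𝔰𝔩(2)` "`M ≅ V(n)`"); consequently, by (1.16) (A1-123 `LefschetzStringInvariantForm.lean`),
its invariant bilinear forms are `(-1)^n`-symmetric, unique up to a scalar, a non-zero one exists, and it is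
non-degenerate (A1-120) — symmetric for `n` even, alternating for `n` odd.  Everything over an ARBITRARY field of
characteristic `0`: for a line `𝔞` the sign is decided by the parity of the depth and no algebraic closure is needed
(contrast A1-120 `isSymm_or_isAlt_of_isIrreducible`, whose Schur argument for a general `𝔞` needs `[IsAlgClosed K]`
and fails over `ℚ`).  THEOREMS ONLY; no definition, no named fact, no `sorry` (D-0026 net debt `0`).

## Sources, VERBATIM

E. Looijenga, V. A. Lunts, *A Lie algebra attached to a projective variety*, Invent. Math. **129** (1997) 361–412
(held TeX text `paper:arxiv-alg-geom_9604014`):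
* §1 (1.16) p0008 L77–L79: "Let us recall that the `𝔰𝔩(2)`-invariant bilinear forms on `V(k)` are generated by a
  nonzero `(-)^k`-symmetric form."
* §1 (1.15) p0008 L1–L5, L43–L46 (the `𝔰𝔩(2)` case "`M ≅ V(n)`"; "It follows that `𝔤` leaves `V(n) ⊗ L` invariant …
  This again contradicts the irreducibility of `M`" — the string-space argument, formalised in A1-118
  `IsLefschetzModule.iSup_map_pow_stable`).
* §1 (1.3) p0005 L9–L11 ("orthogonal (resp. symplectic) representation … a nonzero invariant bilinear form on an
  irreducible representation is either orthogonal or symplectic").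

## Contents (all proved)

* §1 **`IsLefschetzModule.span_string_eq_top_of_isIrreducible`** (for `𝔞 = K·a`, `M` irreducible, `v ∈ M_{-n}`
  non-zero: the `a`-string of `v` spans `M`), `HasLefschetzProperty.pow_depth_apply_ne_zero` (`aⁿv ≠ 0 = a^{n+1}v`).
* §2 **`IsLefschetzModule.flip_eq_smul_of_isIrreducible_line`** (`φᵀ = (-1)^n φ` for every invariant `φ`),
  **`IsLefschetzModule.exists_generator_of_isIrreducible_line`** (a non-zero `(-1)^n`-symmetric invariant form exists
  and every invariant form is a multiple of it), **`IsLefschetzModule.exists_nondegenerate_of_isIrreducible_line`**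
  (a non-degenerate invariant form, symmetric for `n` even, alternating for `n` odd).

## SCOPE

(a) Only the line `𝔞 = K·a` (`𝔤(𝔞, M) ≅ 𝔰𝔩₂`); for a general `𝔞` see A1-120 (dichotomy under `[IsAlgClosed K]`,
with the `ℚ`-counterexample recorded there).  (b) Nothing here concerns complex tori or the Hodge conjecture.

## References

* [LooijengaLunts1997] E. Looijenga, V. A. Lunts, *A Lie algebra attached to a projective variety*, Invent. Math. 129
  (1997) 361–412; arXiv:alg-geom/9604014. §1 (1.15) p. 8, (1.16) p. 8 L77–L79, (1.3) p. 5 of the held TeX text.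
-/

namespace Literature.Algebra.Lie

open Module Function Set
open LinearMap (BilinForm)

-- The commutator Lie ring of `𝔤𝔩(M) = Module.End K M`: Mathlib's reducible NON-instance, enabled file-locally
-- exactly as in `LefschetzModule.lean`.
attribute [local instance 100] LieRing.ofAssociativeRing

/-! ### §1 Irreducible Lefschetz modules over a line are strings; §2 their invariant forms -/

section Line

open HasLefschetzProperty (primitiveSpace)

variable {K : Type*} [Field K] [CharZero K] {M : Type*} [AddCommGroup M] [Module K M] [FiniteDimensional K M]
  {h a : Module.End K M} {B B' : BilinForm K M}

omit [CharZero K] [FiniteDimensional K M] in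
/-- The string space `Σ_i a^i (K·v)` is the span of the `a`-string of `v`. [folklore] -/
private theorem iSup_map_pow_span_singleton (v : M) :
    ⨆ i : ℕ, (K ∙ v).map (a ^ i) = Submodule.span K (Set.range fun j : ℕ ↦ (a ^ j) v) := by
  simp_rw [Submodule.map_span, Set.image_singleton]
  rw [← Submodule.span_iUnion, Set.iUnion_singleton_eq_range]

/-- **An irreducible Lefschetz module over a LINE `𝔞 = K·a` is a single string: `M = K·v + K·av + ⋯ + K·aⁿv` for
any non-zero `v` of bottom degree `-n`, `n = depth M`** — i.e. `M ≅ V(n)`; any field of characteristic `0` (no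
algebraic closure: the string space of `K·v` is `𝔤(K·a, M)`-stable, A1-118 `iSup_map_pow_stable`).
[cite: LooijengaLunts1997, §1 (1.15) p0008 L43–L46] [cite: LooijengaLunts1997, §1 (1.1) p0004 L5–L24 ("V(n)")] -/
theorem IsLefschetzModule.span_string_eq_top_of_isIrreducible (A : IsLefschetzModule K h (K ∙ a)) [Nontrivial M]
    [LieModule.IsIrreducible K (lefschetzLieAlgebra K h (K ∙ a)) M] {f : Module.End K M} (t : IsSl2Triple h a f)
    {v : M} (hv : v ∈ degreeSpace h (-(depth h : ℤ))) (hv0 : v ≠ 0) :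
    Submodule.span K (Set.range fun j : ℕ ↦ (a ^ j) v) = ⊤ := by
  have hL : (K ∙ v) ≤ degreeSpace h (-(depth h : ℤ)) := (Submodule.span_singleton_le_iff_mem _ _).2 hv
  have hLe : ∀ e' ∈ (K ∙ a), ∀ l ∈ (K ∙ v), e' l ∈ (K ∙ v).map a := by
    intro e' he' l hl
    obtain ⟨c, rfl⟩ := Submodule.mem_span_singleton.1 he'
    obtain ⟨d, rfl⟩ := Submodule.mem_span_singleton.1 hl
    refine ⟨(c * d) • v, Submodule.smul_mem _ _ (Submodule.mem_span_singleton_self v), ?_⟩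
    rw [LinearMap.smul_apply, map_smul, map_smul, smul_smul]
  rcases (isIrreducible_iff_forall_stable (h := h) (𝔞 := K ∙ a)).1 ‹_› (⨆ i : ℕ, (K ∙ v).map (a ^ i))
    (fun x hx ↦ A.iSup_map_pow_stable (Submodule.mem_span_singleton_self a) t hL hLe hx) with h1 | h1
  · exfalso
    apply hv0
    have h2 : v ∈ ⨆ i : ℕ, (K ∙ v).map (a ^ i) := by
      simpa using pow_apply_mem_iSup_map_pow (a := a) (Submodule.mem_span_singleton_self v) 0
    rw [h1, Submodule.mem_bot] at h2
    exact h2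
  · rwa [iSup_map_pow_span_singleton] at h1

/-- In an irreducible Lefschetz module over a line, a non-zero bottom vector `v ∈ M_{-n}` has `aⁿv ≠ 0` and
`a^{n+1} v = 0` (`n = depth M`). [cite: LooijengaLunts1997, §1 (1.1) p0004 L58–L60] -/
theorem HasLefschetzProperty.pow_depth_apply_ne_zero (La : HasLefschetzProperty h a) {v : M}
    (hv : v ∈ degreeSpace h (-(depth h : ℤ))) (hv0 : v ≠ 0) :
    (a ^ depth h) v ≠ 0 ∧ (a ^ (depth h + 1)) v = 0 := by
  constructor
  · intro h0
    exact hv0 (La.eq_zero_of_pow_apply_eq_zero (n := depth h) (by omega) hv (by simpa using h0))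
  · have h1 := pow_apply_mem_degreeSpace La.mapsTo hv (depth h + 1)
    rw [show (-(depth h : ℤ) + 2 * ((depth h + 1 : ℕ) : ℤ)) = ((depth h + 2 : ℕ) : ℤ) by push_cast; ring,
      La.degreeSpace_eq_bot_of_depth_lt (by omega), Submodule.mem_bot] at h1
    exact h1

/-- **Invariant bilinear forms on an irreducible Lefschetz module over a LINE `𝔞 = K·a` are `(-1)^n`-symmetric,
`n = depth M`** (the module is `V(n)`, and (1.16) applies) — over ANY field of characteristic `0`; compare A1-120,
where for a general `𝔞` the dichotomy "orthogonal or symplectic" needs `K` algebraically closed.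
[cite: LooijengaLunts1997, §1 (1.16) p0008 L77–L79] [cite: LooijengaLunts1997, §1 (1.3) p0005 L10–L11] -/
theorem IsLefschetzModule.flip_eq_smul_of_isIrreducible_line (A : IsLefschetzModule K h (K ∙ a)) [Nontrivial M]
    [LieModule.IsIrreducible K (lefschetzLieAlgebra K h (K ∙ a)) M] {f : Module.End K M} (t : IsSl2Triple h a f)
    (hh : B.IsSkewAdjoint h) (ha : B.IsSkewAdjoint a) : LinearMap.flip B = ((-1 : K) ^ depth h) • B := by
  have hgr := A.isZGrading
  have La := hasLefschetzProperty_of_isSl2Triple hgr t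
  obtain ⟨v, hv, hv0⟩ := Submodule.exists_mem_ne_zero_of_ne_bot (La.degreeSpace_neg_depth_ne_bot hgr)
  exact flip_eq_smul_of_span_string_eq_top hh ha t.lie_h_e_nsmul hv (A.span_string_eq_top_of_isIrreducible t hv hv0)

/-- **(1.16) for irreducible Lefschetz modules over a line: a non-zero `(-1)^n`-symmetric invariant form exists and
generates all invariant forms** (`n = depth M`; any field of characteristic `0`).
[cite: LooijengaLunts1997, §1 (1.16) p0008 L77–L79] -/
theorem IsLefschetzModule.exists_generator_of_isIrreducible_line (A : IsLefschetzModule K h (K ∙ a)) [Nontrivial M]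
    [LieModule.IsIrreducible K (lefschetzLieAlgebra K h (K ∙ a)) M] {f : Module.End K M} (t : IsSl2Triple h a f) :
    ∃ B : BilinForm K M, B.IsSkewAdjoint h ∧ B.IsSkewAdjoint a ∧ B ≠ 0 ∧
      LinearMap.flip B = ((-1 : K) ^ depth h) • B ∧
      ∀ B' : BilinForm K M, B'.IsSkewAdjoint h → B'.IsSkewAdjoint a → ∃ c : K, B' = c • B := by
  have hgr := A.isZGrading
  have La := hasLefschetzProperty_of_isSl2Triple hgr t
  obtain ⟨v, hv, hv0⟩ := Submodule.exists_mem_ne_zero_of_ne_bot (La.degreeSpace_neg_depth_ne_bot hgr)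
  obtain ⟨h1, h2⟩ := La.pow_depth_apply_ne_zero hv hv0
  exact exists_generator_of_span_string_eq_top t.lie_h_e_nsmul hv h1 h2 (A.span_string_eq_top_of_isIrreducible t hv hv0)

/-- Consequently such a module carries a non-degenerate invariant form which is SYMMETRIC when the depth is even and
ALTERNATING when it is odd ("orthogonal or symplectic" by parity, no algebraic closure needed).
[cite: LooijengaLunts1997, §1 (1.16) p0008 L77–L83] [cite: LooijengaLunts1997, §1 (1.3) p0005 L9–L11] -/
theorem IsLefschetzModule.exists_nondegenerate_of_isIrreducible_line (A : IsLefschetzModule K h (K ∙ a))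
    [Nontrivial M] [LieModule.IsIrreducible K (lefschetzLieAlgebra K h (K ∙ a)) M] {f : Module.End K M}
    (t : IsSl2Triple h a f) :
    ∃ B : BilinForm K M, B.IsSkewAdjoint h ∧ B.IsSkewAdjoint a ∧ B.Nondegenerate ∧
      (Even (depth h) → B.IsSymm) ∧ (Odd (depth h) → LinearMap.IsAlt B) := by
  have hgr := A.isZGrading
  have La := hasLefschetzProperty_of_isSl2Triple hgr t
  obtain ⟨v, hv, hv0⟩ := Submodule.exists_mem_ne_zero_of_ne_bot (La.degreeSpace_neg_depth_ne_bot hgr)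
  have htop := A.span_string_eq_top_of_isIrreducible t hv hv0
  obtain ⟨B, hh, ha, hB, -, -⟩ := A.exists_generator_of_isIrreducible_line t
  have h𝔞 : ∀ e ∈ (K ∙ a), B.IsSkewAdjoint e := by
    intro e he
    obtain ⟨c, rfl⟩ := Submodule.mem_span_singleton.1 he
    intro x y
    have h1 := ha x y
    rw [Pi.neg_apply, map_neg] at h1 ⊢
    rw [LinearMap.smul_apply, LinearMap.smul_apply, map_smul, LinearMap.smul_apply, map_smul, h1, smul_neg]
  exact ⟨B, hh, ha, A.nondegenerate_of_isIrreducible hB hh h𝔞,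
    fun he ↦ isSymm_of_span_string_eq_top hh ha t.lie_h_e_nsmul he hv htop,
    fun ho ↦ isAlt_of_span_string_eq_top hh ha t.lie_h_e_nsmul ho hv htop⟩

end Line

end Literature.Algebra.Lie
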